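import Literature.NumberTheory.EllipticCurves.SelmerFiniteProofs
import Mathlib.Analysis.SpecialFunctions.Log.Basic
import HarnessLib

/-!
# A uniform lower bound for the absolute value of a non-integral element of `K̄_v` in terms of its
# degree over `K_v`: `log |z|_v ≥ b_v / [K_v(z) : K_v]` (proofs only)

`Proofs`-style file (THEOREMS ONLY), topic `NumberTheory/EllipticCurves`; companion of
`SupersingularTorsionDegreeBoundProofs` (the same computation over `ℚ_p`) for the completion `K_v`
of a number field at a finite place. Neukirch, *Algebraic Number Theory*, Ch. II (4.8): the spectral
norm of `z ∈ K̄_v` is `|a₀|^{1/d}`, `a₀` the constant coefficient and `d` the degree of its minimal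
polynomial (Mathlib `spectralNorm_eq_norm_coeff_zero_rpow`); and `|K_v^×| = |ϖ|^ℤ` is discrete, so a
non-integral `a₀ ∈ K_v` has `|a₀| ≥ |ϖ|⁻¹`. Hence:

* `exists_one_lt_forall_le_norm_of_one_lt` — there is `δ > 1` with `δ ≤ ‖a‖` for every `a ∈ K_v`
  with `‖a‖ > 1` (`δ = ‖ϖ‖⁻¹`);
* `exists_pos_forall_div_index_le_log_spectralValuation` — **there is `b > 0` (depending on `K`,
  `v` only) such that every `z ∈ K̄_v` with `|z|_v > 1` fixed by a subgroup `H ≤ Gal(K̄_v/K_v)` of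
  finite index satisfies `b / [Γ : H] ≤ log |z|_v`** (`z` lies in the fixed field of `H`, of degree
  `[Γ : H]`, so `deg z ≤ [Γ : H]` and `[Γ:H]·log|z| ≥ deg z · log|z| = log|a₀| ≥ log δ`).

This is the «`v(x) ≥ c₄/e`» step of Serre, Driebergen 1966, §5 Lemme 3 (with the degree in place of
the ramification index), in the form consumed by the tree's abstract assembly
`Serre1967.eq_bot_of_stable_divisible_of_contraction` (hypothesis `hlow`).

## References

* J. Neukirch, *Algebraic Number Theory*, Grundlehren 322 (1999), Ch. II Thm. (4.8), (6.2).
  [NeukirchANT1999]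
* J.-P. Serre, Proc. Conf. Local Fields (Driebergen 1966), Springer 1967, §5, proof of Lemme 3.
  [Serre1967GroupesPDivisibles]
-/

noncomputable section

open scoped Classical NNReal

universe u

namespace IsDedekindDomain.HeightOneSpectrum

open NumberField Field Literature.NumberTheory.EllipticCurves

variable {K : Type u} [Field K] [NumberField K] (v : HeightOneSpectrum (𝓞 K))

/-- **The value group of `K_v` is discrete**: there is `δ > 1` (namely `‖ϖ‖⁻¹` for a uniformiser
`ϖ`) with `δ ≤ ‖a‖` for every `a ∈ K_v` of norm `> 1` (`a⁻¹` lies in the maximal ideal `(ϖ)` of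
`𝓞_v`). [cite: NeukirchANT1999, Ch. II Prop. (3.8) and (6.2)] -/
theorem exists_one_lt_forall_le_norm_of_one_lt :
    ∃ δ : ℝ, 1 < δ ∧ ∀ a : v.adicCompletion K, 1 < ‖a‖ → δ ≤ ‖a‖ := by
  set O := v.adicCompletionIntegers K with hO
  obtain ⟨ϖ, hϖ⟩ := IsDiscreteValuationRing.exists_irreducible O
  have hϖne : (ϖ : v.adicCompletion K) ≠ 0 := by
    intro h
    apply hϖ.ne_zero
    exact Subtype.ext h
  have hϖ0 : 0 < ‖(ϖ : v.adicCompletion K)‖ := norm_pos_iff.mpr hϖne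
  have hϖ1 : ‖(ϖ : v.adicCompletion K)‖ < 1 := by
    have hnu : ¬ IsUnit ϖ := hϖ.not_isUnit
    rw [adicCompletionIntegers.isUnit_iff_valued_eq_one] at hnu
    have hle : Valued.v (ϖ : v.adicCompletion K) ≤ 1 := (mem_adicCompletionIntegers (𝓞 K) K v).mp ϖ.2
    rw [Valued.toNormedField.norm_lt_one_iff]
    exact lt_of_le_of_ne hle hnu
  refine ⟨‖(ϖ : v.adicCompletion K)‖⁻¹, one_lt_inv_iff₀.mpr ⟨hϖ0, hϖ1⟩, fun a ha => ?_⟩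
  have ha0 : a ≠ 0 := by
    rintro rfl
    rw [norm_zero] at ha
    exact absurd ha (not_lt.mpr zero_le_one)
  -- `b = a⁻¹` lies in the maximal ideal `(ϖ)` of `𝓞_v`
  have hb1 : ‖a⁻¹‖ < 1 := by
    rw [norm_inv]; exact inv_lt_one_of_one_lt₀ ha
  have hbO : a⁻¹ ∈ O := by
    rw [hO, mem_adicCompletionIntegers (𝓞 K) K v, ← Valued.toNormedField.norm_le_one_iff]
    exact hb1.le
  set b : O := ⟨a⁻¹, hbO⟩ with hb
  have hbnu : ¬ IsUnit b := by
    rw [adicCompletionIntegers.isUnit_iff_valued_eq_one]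
    have : Valued.v (a⁻¹ : v.adicCompletion K) < 1 := by
      rwa [← Valued.toNormedField.norm_lt_one_iff]
    exact this.ne
  have hbmax : b ∈ IsLocalRing.maximalIdeal O := (IsLocalRing.mem_maximalIdeal _).mpr hbnu
  rw [hϖ.maximalIdeal_eq, Ideal.mem_span_singleton'] at hbmax
  obtain ⟨c, hc⟩ := hbmax
  have hc1 : ‖(c : v.adicCompletion K)‖ ≤ 1 := by
    rw [Valued.toNormedField.norm_le_one_iff]
    exact (mem_adicCompletionIntegers (𝓞 K) K v).mp c.2
  have hcoe : (c : v.adicCompletion K) * (ϖ : v.adicCompletion K) = a⁻¹ := by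
    have := congrArg (fun t : O => (t : v.adicCompletion K)) hc
    simpa [hb] using this
  have hle : ‖a⁻¹‖ ≤ ‖(ϖ : v.adicCompletion K)‖ := by
    rw [← hcoe, norm_mul]
    calc ‖(c : v.adicCompletion K)‖ * ‖(ϖ : v.adicCompletion K)‖
        ≤ 1 * ‖(ϖ : v.adicCompletion K)‖ := mul_le_mul_of_nonneg_right hc1 (norm_nonneg _)
      _ = _ := one_mul _
  rw [norm_inv] at hle
  have ha' : 0 < ‖a‖ := lt_trans zero_lt_one ha
  exact (inv_le_comm₀ ha' hϖ0).mp hle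

variable {v} {w : Valuation (AlgebraicClosure (v.adicCompletion K)) ℝ≥0}
  (hw : ∀ x, (w x : ℝ) = spectralNorm (v.adicCompletion K) (AlgebraicClosure (v.adicCompletion K)) x)
include hw

/-- **`log |z|_v ≥ b_v / [Γ_{K_v} : H]` for non-integral `z ∈ K̄_v` fixed by a finite-index
`H ≤ Gal(K̄_v/K_v)`.** There is `b > 0` depending only on `(K, v)` such that for every
`z ∈ K̄_v` with `|z|_v > 1` and every subgroup `H` of finite index fixing `z`:
`b / [Γ : H] ≤ log |z|_v`. Proof: `z` lies in the fixed field of `H`, of degree `[Γ : H]` over `K_v`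
(`IntermediateField.finrank_eq_fixingSubgroup_index`), so `d = deg_{K_v} z ≤ [Γ : H]`; `|z|_v^d = ‖a₀‖`
for the constant coefficient `a₀ ∈ K_v` of its minimal polynomial (Neukirch II (4.8), Mathlib
`spectralNorm_eq_norm_coeff_zero_rpow`), and `‖a₀‖ > 1` forces `‖a₀‖ ≥ δ > 1`
(`exists_one_lt_forall_le_norm_of_one_lt`). [cite: NeukirchANT1999, Ch. II Thm. (4.8)] -/
theorem exists_pos_forall_div_index_le_log_spectralValuation :
    ∃ b : ℝ, 0 < b ∧ ∀ (z : AlgebraicClosure (v.adicCompletion K)), 1 < w z →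
      ∀ H : Subgroup (AlgebraicClosure (v.adicCompletion K) ≃ₐ[v.adicCompletion K]
          AlgebraicClosure (v.adicCompletion K)),
        H.index ≠ 0 → (∀ σ ∈ H, σ z = z) → b / H.index ≤ Real.log (w z) := by
  obtain ⟨δ, hδ1, hδ⟩ := exists_one_lt_forall_le_norm_of_one_lt v
  refine ⟨Real.log δ, Real.log_pos hδ1, fun z hz H hH0 hfix => ?_⟩
  haveI : CharZero (v.adicCompletion K) :=
    charZero_of_injective_algebraMap (algebraMap K (v.adicCompletion K)).injective
  -- `z` lies in the fixed field of `H`, of degree `≤ [Γ : H]`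
  set F : IntermediateField (v.adicCompletion K) (AlgebraicClosure (v.adicCompletion K)) :=
    IntermediateField.fixedField H with hF
  have hzF : z ∈ F := by
    rw [hF, IntermediateField.mem_fixedField_iff]
    exact fun σ hσ ↦ hfix σ hσ
  have hle : H ≤ F.fixingSubgroup := (IntermediateField.le_iff_le H F).mp le_rfl
  have hdvd : F.fixingSubgroup.index ∣ H.index := Subgroup.index_dvd_of_le hle
  have hfin : Module.finrank (v.adicCompletion K) F = F.fixingSubgroup.index :=
    IntermediateField.finrank_eq_fixingSubgroup_index F
  have hFidx0 : F.fixingSubgroup.index ≠ 0 := fun h0 ↦ hH0 (Nat.eq_zero_of_zero_dvd (h0 ▸ hdvd))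
  have hFpos : 0 < Module.finrank (v.adicCompletion K) F := by rw [hfin]; exact Nat.pos_of_ne_zero hFidx0
  haveI : FiniteDimensional (v.adicCompletion K) F := Module.finite_of_finrank_pos hFpos
  have hFle : Module.finrank (v.adicCompletion K) F ≤ H.index := hfin ▸ Nat.le_of_dvd (Nat.pos_of_ne_zero hH0) hdvd
  have hint : IsIntegral (v.adicCompletion K) z := Algebra.IsIntegral.isIntegral z
  have hdpos : 0 < (minpoly (v.adicCompletion K) z).natDegree := minpoly.natDegree_pos hint
  have hdeg : (minpoly (v.adicCompletion K) z).natDegree ≤ Module.finrank (v.adicCompletion K) F := by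
    have h := minpoly.natDegree_le (A := v.adicCompletion K) (⟨z, hzF⟩ : F)
    rwa [IntermediateField.minpoly_eq] at h
  have hdle : (minpoly (v.adicCompletion K) z).natDegree ≤ H.index := hdeg.trans hFle
  -- `|z|^d = ‖a₀‖`
  letI := Valued.toNontriviallyNormedField (v.adicCompletion K) (WithZero (Multiplicative ℤ))
  have hwx : (w z : ℝ) = ‖(minpoly (v.adicCompletion K) z).coeff 0‖ ^
      (1 / ((minpoly (v.adicCompletion K) z).natDegree : ℝ)) := by
    rw [hw z]
    exact spectralNorm.spectralNorm_eq_norm_coeff_zero_rpow (v.adicCompletion K)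
      (AlgebraicClosure (v.adicCompletion K)) z
  have hwxd : (w z : ℝ) ^ (minpoly (v.adicCompletion K) z).natDegree =
      ‖(minpoly (v.adicCompletion K) z).coeff 0‖ := by
    rw [hwx, ← Real.rpow_natCast, ← Real.rpow_mul (norm_nonneg _),
      one_div_mul_cancel (Nat.cast_ne_zero.mpr hdpos.ne'), Real.rpow_one]
  have hz1 : 1 < (w z : ℝ) := by exact_mod_cast hz
  have ha1 : 1 < ‖(minpoly (v.adicCompletion K) z).coeff 0‖ := by
    rw [← hwxd]
    exact one_lt_pow₀ hz1 hdpos.ne'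
  have haδ : δ ≤ ‖(minpoly (v.adicCompletion K) z).coeff 0‖ := hδ _ ha1
  -- logarithms
  have hlogz : 0 < Real.log (w z) := Real.log_pos hz1
  have hdlog : Real.log δ ≤ (minpoly (v.adicCompletion K) z).natDegree * Real.log (w z) := by
    rw [← Real.log_pow, hwxd]
    exact Real.log_le_log (lt_trans zero_lt_one hδ1) haδ
  have hidx : (0 : ℝ) < H.index := by exact_mod_cast Nat.pos_of_ne_zero hH0
  rw [div_le_iff₀ hidx]
  calc Real.log δ ≤ (minpoly (v.adicCompletion K) z).natDegree * Real.log (w z) := hdlog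
    _ ≤ H.index * Real.log (w z) := by
        refine mul_le_mul_of_nonneg_right ?_ hlogz.le
        exact_mod_cast hdle
    _ = Real.log (w z) * H.index := mul_comm _ _

end IsDedekindDomain.HeightOneSpectrum

end
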